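import Summits.CriticalPhenomena.SAWScalingLimit.Theses.SAWRenewalTightness
import Summits.CriticalPhenomena.SAWScalingLimit.Theorems.SAWRenewalTightnessEventualTightSketchDefs
import Summits.CriticalPhenomena.SAWScalingLimit.Theorems.EventualTight.Negative.TightnessNecessary
import Summits.CriticalPhenomena.SAWScalingLimit.Theorems.SAWRenewalTightnessShellCrossingBoundSplit
import Summits.CriticalPhenomena.SAWScalingLimit.Theorems.SAWRenewalTightnessTightOfShellCrossing
import Literature.Probability.RandomPlanarGeometry.SAWBridges

/-!
# Crux-strategist sketch — `EventualTight` (stmt-CriticalPhenomena-1372): STRENGTHEN / TRANSFER / NEGATION probes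

Companion of `STRATEGY-CENSUS.md` (this seat).  Every `S⁺` below is a typed candidate; the short
theorems record where it sits relative to the two children of the filed split
(`ConfinementPositivity`, `BulkShellTight`, route rev 2) and to the crux.  No `sorry`.
-/

noncomputable section
open MeasureTheory Set Metric Filter Topology
open scoped unitInterval ENNReal BigOperators
open Literature.Probability.RandomPlanarGeometry Literature.Probability.LatticeModels

namespace Summit.CriticalPhenomena.SAWScalingLimit.Cruxes.EventualTight.Strategist

/-! ### The two children (verbatim the route decls of rev 2) -/

/-- Child 1 (stmt-17587). -/
def ConfinementPositivity : Prop :=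
  ∀ (D D' : DobrushinDomain) (a b : ℝ → Site 2) (d : ℝ), 0 < d →
    D'.carrier ⊆ D.carrier → D'.pt 0 = D.pt 0 → D'.pt 1 = D.pt 1 →
    D.carrier ∩ (Metric.ball (D.pt 0) d ∪ Metric.ball (D.pt 1) d) ⊆ D'.carrier →
    SAW.IsEndpointApprox D' a b →
      ∃ c δ₀ : ℝ, 0 < c ∧ 0 < δ₀ ∧ ∀ δ ∈ Set.Ioc (0 : ℝ) δ₀,
        ENNReal.ofReal c ≤ SAW.law D.carrier δ (a δ) (b δ)
          {γ | ∃ γ' : SAW.DomainSAW D'.carrier δ (a δ) (b δ), γ'.walk.support = γ.walk.support}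

/-- Child 2 (stmt-17588). -/
def BulkShellTight : Prop :=
  ∀ (D : DobrushinDomain) (a b : ℝ → Site 2), SAW.IsEndpointApprox D a b →
    ∀ (y : ℂ) (η R : ℝ), 0 < η → η < R → Metric.closedBall y (2 * R) ⊆ D.carrier →
      ∀ ε : ℝ, 0 < ε → ∃ (j : ℕ) (δ₁ : ℝ), 0 < δ₁ ∧ ∀ δ ∈ Set.Ioc (0 : ℝ) δ₁,
        SAW.law D.carrier δ (a δ) (b δ)
          {γ | (⟨γ.walk.toCurve (meshPoint δ)⟩ : Curve ℂ).HasTraversals j y η R} ≤ ENNReal.ofReal ε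

/-- The split glue, kernel-checked (the content of the evidence file
`SAWRenewalTightnessEventualTightSplit.lean` / glue item stmt-17589). -/
theorem eventualTight_of_children (hE : ConfinementPositivity) (hB : BulkShellTight) :
    Summit.CriticalPhenomena.SAWScalingLimit.Theses.SAWRenewalTightness.EventualTight :=
  Theorems.TightOfShellCrossing_proof (Theorems.ShellCrossingBound_of_subs hE hB)

/-! ### STRENGTHEN probes -/

/-- **S⁺₁ `ExpShellTail`** — a RATE in the threshold: per interior shell, a geometric tail of the
separate-traversal count, uniformly in small meshes.  The natural "strengthen-to-induct" form
(sub-multiplicativity in `k` ⟸ a one-step conditional bound `P[N ≥ k+2 ∣ N ≥ k, past] ≤ q`), i.e. the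
Kemppainen–Smirnov engine; predicted true (`P[N ≥ 2j] ≍ (η/R)^{x_{2j}}`). -/
def ExpShellTail : Prop :=
  ∀ (D : DobrushinDomain) (a b : ℝ → Site 2), SAW.IsEndpointApprox D a b →
    ∀ (y : ℂ) (η R : ℝ), 0 < η → η < R → Metric.closedBall y (2 * R) ⊆ D.carrier →
      ∃ (C q δ₁ : ℝ), 0 < C ∧ 0 < q ∧ q < 1 ∧ 0 < δ₁ ∧ ∀ k : ℕ, ∀ δ ∈ Set.Ioc (0 : ℝ) δ₁,
        SAW.law D.carrier δ (a δ) (b δ)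
          {γ | (⟨γ.walk.toCurve (meshPoint δ)⟩ : Curve ℂ).HasTraversals k y η R}
          ≤ ENNReal.ofReal (C * q ^ k)

/-- `S⁺₁` sits above child 2: a geometric tail gives per-shell tightness (choose `k` with
`C q^k ≤ ε`). -/
theorem bulkShellTight_of_expShellTail (h : ExpShellTail) : BulkShellTight := by
  intro D a b hab y η R hη hηR hball ε hε
  obtain ⟨C, q, δ₁, hC, hq, hq1, hδ₁, hk⟩ := h D a b hab y η R hη hηR hball
  -- `q^k → 0`, so some `k` has `C * q^k ≤ ε`
  have htend : Tendsto (fun k : ℕ => C * q ^ k) atTop (𝓝 (C * 0)) :=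
    (tendsto_pow_atTop_nhds_zero_of_lt_one hq.le hq1).const_mul C
  rw [mul_zero] at htend
  obtain ⟨k, hk'⟩ := (htend.eventually (gt_mem_nhds hε)).exists
  exact ⟨k, δ₁, hδ₁, fun δ hδ => (hk k δ hδ).trans (ENNReal.ofReal_le_ofReal hk'.le)⟩

/-- **S⁺₂ `BulkQuasiMult`** — quasi-multiplicativity of the `k`-traversal probability in the aspect
ratio on interior shells (one intermediate radius): the form that would let one INDUCT on
`log (R/η)` from a single sub-unit scale.  Needs decoupling of strands of ONE walk across the middle
circle (domain Markov + a two-pinned ratio) — the RSW floor; recorded, not bet on. -/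
def BulkQuasiMult : Prop :=
  ∀ (D : DobrushinDomain) (a b : ℝ → Site 2), SAW.IsEndpointApprox D a b →
    ∀ (y : ℂ) (k : ℕ), ∃ (C δ₁ : ℝ), 0 < C ∧ 0 < δ₁ ∧
      ∀ (η r R : ℝ), 0 < η → η < r → r < R → Metric.closedBall y (2 * R) ⊆ D.carrier →
        ∀ δ ∈ Set.Ioc (0 : ℝ) δ₁,
          SAW.law D.carrier δ (a δ) (b δ)
              {γ | (⟨γ.walk.toCurve (meshPoint δ)⟩ : Curve ℂ).HasTraversals k y η R}
            ≤ ENNReal.ofReal C *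
              SAW.law D.carrier δ (a δ) (b δ)
                {γ | (⟨γ.walk.toCurve (meshPoint δ)⟩ : Curve ℂ).HasTraversals k y η r} *
              SAW.law D.carrier δ (a δ) (b δ)
                {γ | (⟨γ.walk.toCurve (meshPoint δ)⟩ : Curve ℂ).HasTraversals k y r R}

/-- **S⁺₃ `ConfinementRatioConverges`** (strengthening of child 1 to identification level): the
confinement probability has a positive LIMIT along `δ → 0⁺` (predicted: the SLE₈⸝₃ restriction value
`(Φ'(a)Φ'(b))^{5/8}`).  Strictly stronger than child 1; its only known source is the scaling limit
itself. -/
def ConfinementRatioConverges : Prop :=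
  ∀ (D D' : DobrushinDomain) (a b : ℝ → Site 2) (d : ℝ), 0 < d →
    D'.carrier ⊆ D.carrier → D'.pt 0 = D.pt 0 → D'.pt 1 = D.pt 1 →
    D.carrier ∩ (Metric.ball (D.pt 0) d ∪ Metric.ball (D.pt 1) d) ⊆ D'.carrier →
    SAW.IsEndpointApprox D' a b →
      ∃ c : ℝ, 0 < c ∧ Tendsto (fun δ => SAW.law D.carrier δ (a δ) (b δ)
          {γ | ∃ γ' : SAW.DomainSAW D'.carrier δ (a δ) (b δ), γ'.walk.support = γ.walk.support})
        (𝓝[>] 0) (𝓝 (ENNReal.ofReal c))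

/-- `S⁺₃ → child 1` (a positive limit gives an eventual positive lower bound, `c/2`). -/
theorem confinementPositivity_of_converges (h : ConfinementRatioConverges) : ConfinementPositivity := by
  intro D D' a b d hd hsub h0 h1 hsock hab
  obtain ⟨c, hc, ht⟩ := h D D' a b d hd hsub h0 h1 hsock hab
  have hlt : ENNReal.ofReal (c / 2) < ENNReal.ofReal c :=
    (ENNReal.ofReal_lt_ofReal_iff hc).2 (by linarith)
  have hev := ht.eventually (lt_mem_nhds hlt)
  obtain ⟨δ₀, hδ₀, hI⟩ := (mem_nhdsGT_iff_exists_Ioc_subset).1 hev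
  exact ⟨c / 2, δ₀, half_pos hc, hδ₀, fun δ hδ => (hI hδ).le⟩

/-- **S⁺₄ `TubeTwoSided`** (strip hyperscaling, both sides; lattice units on `ℤ²`): the `x_c`-mass
of bridges of span `L` confined to the strip `0 ≤ ω₂ ≤ W` is between `e^{-κ₁ L/W}` and
`C e^{-κ₀ L/W}`.  The LOWER half is what child 1 contains on tube pairs (a thin tube `D` inside a fat
enlargement); the UPPER half is the one-strand primitive W1.  Both open on `ℤ²` (only `μ_W < μ`
per fixed `W`, and `Σ_{span} u_L ≤ 1`, are available). -/
def TubeTwoSided : Prop :=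
  ∃ κ₀ κ₁ C : ℝ, 0 < κ₀ ∧ 0 < κ₁ ∧ 0 < C ∧ ∀ (W : ℕ) (L : ℤ), 1 ≤ W → (W : ℤ) ≤ L →
    (∃ N : ℕ, Real.exp (-(κ₁ * L / W)) ≤
      ∑ n ∈ Finset.range (N + 1), ∑ _ω ∈ (SAW.Zd.bridges 2 n).filter
        (fun ω => ω n 0 = L ∧ ∀ i ≤ n, 0 ≤ ω i 1 ∧ ω i 1 ≤ (W : ℤ)), SAW.criticalFugacity ^ n) ∧
    (∀ N : ℕ, ∑ n ∈ Finset.range (N + 1), ∑ _ω ∈ (SAW.Zd.bridges 2 n).filter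
        (fun ω => ω n 0 = L ∧ ∀ i ≤ n, 0 ≤ ω i 1 ∧ ω i 1 ≤ (W : ℤ)), SAW.criticalFugacity ^ n
      ≤ C * Real.exp (-(κ₀ * L / W)))

/-! ### NEGATION probe: the crux and child 2 cannot be refuted short of the summit conjunct -/

/-- `¬ EventualTight → ¬ SAWScalingLimit` (landed `TightnessNecessary`), restated for the record. -/
theorem not_summit_of_not_crux
    (h : ¬ Summit.CriticalPhenomena.SAWScalingLimit.Theses.SAWRenewalTightness.EventualTight) :
    ¬ SAW.SAWScalingLimit :=
  Theorems.EventualTight.Negative.not_sawScalingLimit_of_not_eventualTight h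

end Summit.CriticalPhenomena.SAWScalingLimit.Cruxes.EventualTight.Strategist
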